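import Literature.NumberTheory.QuadraticFields.QuadraticIrrationalGaussReduction
import Literature.NumberTheory.QuadraticFields.QuadraticIrrationalDuplication
import Mathlib.Data.Int.Lemmas
import HarnessLib

/-!
# The infrastructure primitives as exact integer programs: baby step, Gauss step, normalisation,
# reduction — integer formulas, invariants and size bounds

Topic `Computability/Cryptography`; the arithmetic layer under the `FP` implementation of Hallgren's
walk (`InfrastructureWalkFP.lean`: `IntWalkOps`/`FPSpec` ask for the baby step `ρ` and the giant
step as TOTAL functions on integer codes, closed on a validity predicate with polynomially bounded
codes). The cycle files (`QuadraticFields/ReducedQuadraticIrrationals*.lean`,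
`…Modules.lean`, `QuadraticIrrationalGaussReduction.lean`) define `step`, `gaussStep`, `normalize`,
`reduce` on `QuadIrr D` through two REAL floors (`⌊(P + √D)/Q⌋`, `⌊(√D − P)/Q⌋`); this
theorem-and-definition file (no named facts) replaces them by integer arithmetic and records what the
typed-`FP` layer needs:

* `floor_div_of_pos` (`⌊t/Q⌋ = ⌊t⌋/Q`), `floor_sqrt` (`⌊√D⌋ = Nat.sqrt D`), hence
  **`pq_eq_ediv`** (`⌊(P + √D)/Q⌋ = (P + ⌊√D⌋)/Q` for `Q > 0`) and `normShift_eq_ediv`;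
* the integer programs on pairs `(P, Q)` with the parameter `D`: `rhoI` (`= step`, `rhoI_pair`),
  `stepWithI`, `gaussStepI` (`= gaussStep` unconditionally, `gaussStepI_pair`), `normalizeI`
  (`= normalize` for `Q > 0`), the guard `Good D p` (`D` non-square, `Q > 0`, `Q ∣ D − P²`;
  decidable through `Nat.sqrt`), the guarded step `gStepI` (frozen off the guard, `gStepI_iterate`)
  and **`reduceI`** (`= reduce`, `reduceI_pair`);
* invariants: `IsIdealShaped` is preserved by `stepWith`, `flipQ`, `shiftP`, hence by `step`,
  `gaussStep`, `normalize`, `reduce` (Jozsa 2003 §6.2: the reduction operates on ideals);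
* size bounds along the guarded Gauss iteration for EVERY input passing the guard
  (`abs_P_gaussIter_le`, `Q_gaussIter_le`: `|P|, Q ≤ max(|P₀|, Q₀, D)`), and for reduced data
  (`IsReduced.natAbs_P_le`, `IsReduced.Q_le`).

## References

* R. Jozsa, arXiv:quant-ph/0302134 (2003), §6.2 Prop. 21, §9 (proof of Thm. 5). [Jozsa2003]
* M. J. Jacobson, Jr., H. C. Williams, *Solving the Pell Equation*, Springer (2009), §3.1 (3.11),
  §3.2 (q_i = ⌊(P_i + ⌊√D⌋)/Q_i⌋ for Q_i > 0), §5.4. [JacobsonWilliams2008]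
-/

noncomputable section

open scoped Classical

namespace Literature.Computability.Cryptography

namespace InfraPrimitives

open Literature.NumberTheory.QuadraticFields Literature.NumberTheory.QuadraticFields.QuadIrr

variable {D : ℕ}

/-! ### Floors through `Nat.sqrt` -/

/-- `⌊t / Q⌋ = ⌊t⌋ / Q` for an integer `Q > 0` (floor division). [folklore] -/
theorem floor_div_of_pos (t : ℝ) {Q : ℤ} (hQ : 0 < Q) : ⌊t / Q⌋ = ⌊t⌋ / Q := by
  set n := ⌊t⌋ with hn
  have hQ' : (0 : ℝ) < Q := by exact_mod_cast hQ
  have h0 := Int.emod_add_mul_ediv n Q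
  have h1 : Q * (n / Q) ≤ n := by
    have := Int.emod_nonneg n hQ.ne'
    linarith
  have h2 : n < Q * (n / Q) + Q := by
    have := Int.emod_lt_of_pos n hQ
    linarith
  rw [Int.floor_eq_iff]
  constructor
  · rw [le_div_iff₀ hQ']
    have : ((Q * (n / Q) : ℤ) : ℝ) ≤ (n : ℝ) := by exact_mod_cast h1
    push_cast at this
    have hn' : (n : ℝ) ≤ t := Int.floor_le t
    linarith
  · rw [div_lt_iff₀ hQ']
    have : ((n + 1 : ℤ) : ℝ) ≤ ((Q * (n / Q) + Q : ℤ) : ℝ) := by exact_mod_cast h2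
    push_cast at this
    have hn' : t < (n : ℝ) + 1 := Int.lt_floor_add_one t
    linarith

/-- `⌊√D⌋ = Nat.sqrt D`. [folklore] -/
theorem floor_sqrt (D : ℕ) : ⌊Real.sqrt D⌋ = (Nat.sqrt D : ℤ) := by
  rw [Int.floor_eq_iff]
  constructor
  · exact_mod_cast Real.nat_sqrt_le_real_sqrt
  · exact_mod_cast Real.real_sqrt_lt_nat_sqrt_succ

/-- **The partial quotient in integers**: `⌊(P + √D)/Q⌋ = (P + ⌊√D⌋)/Q` for `Q > 0`.
[cite: JacobsonWilliams2008, §3.2 (q_i = ⌊(P_i + ⌊√D⌋)/Q_i⌋)] -/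
theorem pq_eq_ediv {x : QuadIrr D} (hQ : 0 < x.Q) : x.pq = (x.P + Nat.sqrt D) / x.Q := by
  unfold pq val
  rw [floor_div_of_pos _ hQ]
  congr 1
  rw [show (x.P : ℝ) + Real.sqrt D = Real.sqrt D + x.P by ring, Int.floor_add_intCast, floor_sqrt]
  ring

/-- **The normalising shift in integers**: `⌊(√D − P)/Q⌋ = (⌊√D⌋ − P)/Q` for `Q > 0`.
[cite: JacobsonWilliams2008, §5.1 (proof of Thm. 5.9)] -/
theorem normShift_eq_ediv {x : QuadIrr D} (hQ : 0 < x.Q) :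
    ⌊(Real.sqrt D - x.P) / x.Q⌋ = ((Nat.sqrt D : ℤ) - x.P) / x.Q := by
  rw [floor_div_of_pos _ hQ, Int.floor_sub_intCast, floor_sqrt]

/-! ### The integer programs -/

/-- Pairs `(P, Q)` of a quotient. [folklore] -/
def pr (x : QuadIrr D) : ℤ × ℤ := (x.P, x.Q)

/-- `pr` is injective. [folklore] -/
theorem pr_injective : Function.Injective (pr (D := D)) := by
  rintro ⟨P, Q⟩ ⟨P', Q'⟩ h
  simp only [pr, Prod.mk.injEq] at h
  obtain ⟨rfl, rfl⟩ := h; rfl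

/-- The step with an arbitrary quotient on pairs. [cite: JacobsonWilliams2008, §3.1 (3.11)] -/
def stepWithI (D : ℕ) (p : ℤ × ℤ) (q : ℤ) : ℤ × ℤ :=
  (q * p.2 - p.1, ((D : ℤ) - (q * p.2 - p.1) ^ 2) / p.2)

/-- `stepWithI` is `stepWith`. [folklore] -/
theorem stepWithI_pr (x : QuadIrr D) (q : ℤ) : stepWithI D (pr x) q = pr (stepWith x q) := rfl

/-- **The baby step `ρ` in integers** (quotient `(P + ⌊√D⌋)/Q`). [cite: JacobsonWilliams2008, §3.2] -/
def rhoI (D : ℕ) (p : ℤ × ℤ) : ℤ × ℤ := stepWithI D p ((p.1 + Nat.sqrt D) / p.2)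

/-- `rhoI = step` on quotients with `Q > 0`. [cite: JacobsonWilliams2008, §3.2] -/
theorem rhoI_pr {x : QuadIrr D} (hQ : 0 < x.Q) : rhoI D (pr x) = pr (step x) := by
  rw [step_eq_stepWith, ← stepWithI_pr, pq_eq_ediv hQ]; rfl

/-- The Gauss step on pairs (an exact transcription of `gaussStep`: nearest-integer quotient, sign
of `Q'` fixed, identity when `Q² < D`). [cite: Jozsa2003, §6.2 Prop. 21] -/
def gaussStepI (D : ℕ) (p : ℤ × ℤ) : ℤ × ℤ :=
  if p.2 ^ 2 < (D : ℤ) then p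
  else
    let r := stepWithI D p ((2 * p.1 + p.2) / (2 * p.2))
    if 0 < r.2 then r else (r.1, -r.2)

/-- `gaussStepI = gaussStep`, unconditionally. [cite: Jozsa2003, §6.2 Prop. 21] -/
theorem gaussStepI_pr (x : QuadIrr D) : gaussStepI D (pr x) = pr (gaussStep x) := by
  have h1 : stepWithI D (pr x) ((2 * x.P + x.Q) / (2 * x.Q)) = pr (gaussRaw x) := rfl
  unfold gaussStepI gaussStep
  simp only [show (pr x).1 = x.P from rfl, show (pr x).2 = x.Q from rfl, h1,
    show (pr (gaussRaw x)).2 = (gaussRaw x).Q from rfl]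
  split_ifs <;> rfl

/-- Iterates agree. [folklore] -/
theorem gaussStepI_iterate_pr (x : QuadIrr D) (n : ℕ) : (gaussStepI D)^[n] (pr x) = pr (gaussStep^[n] x) := by
  induction n generalizing x with
  | zero => rfl
  | succ n ih => rw [Function.iterate_succ_apply, Function.iterate_succ_apply, gaussStepI_pr, ih]

/-- Normalisation on pairs (shift `(⌊√D⌋ − P)/Q`). [cite: JacobsonWilliams2008, §5.1 Thm. 5.9] -/
def normalizeI (D : ℕ) (p : ℤ × ℤ) : ℤ × ℤ := (p.1 + ((Nat.sqrt D : ℤ) - p.1) / p.2 * p.2, p.2)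

/-- `normalizeI = normalize` for `Q > 0`. [cite: JacobsonWilliams2008, §5.1 Thm. 5.9] -/
theorem normalizeI_pr {x : QuadIrr D} (hQ : 0 < x.Q) : normalizeI D (pr x) = pr (QuadIrr.normalize x) := by
  unfold normalizeI QuadIrr.normalize shiftP
  simp only [pr, normShift_eq_ediv hQ]

/-- **The guard**: `D` is not a square, `Q > 0`, `Q ∣ D − P²` (admissible data with positive `Q`).
[cite: Jozsa2003, §6.2 Prop. 21 (hypotheses)] -/
def Good (D : ℕ) (p : ℤ × ℤ) : Prop := ¬ IsSquare D ∧ 0 < p.2 ∧ p.2 ∣ (D : ℤ) - p.1 ^ 2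

/-- The guard in terms of `Nat.sqrt` (for the program). [folklore] -/
theorem good_iff (D : ℕ) (p : ℤ × ℤ) :
    Good D p ↔ Nat.sqrt D * Nat.sqrt D ≠ D ∧ 0 < p.2 ∧ ((D : ℤ) - p.1 ^ 2) % p.2 = 0 := by
  unfold Good
  have h1 : ¬ IsSquare D ↔ Nat.sqrt D * Nat.sqrt D ≠ D := by
    rw [Ne, ← Nat.exists_mul_self D]
    constructor
    · rintro h ⟨n, hn⟩; exact h ⟨n, hn.symm⟩
    · rintro h ⟨n, hn⟩; exact h ⟨n, hn.symm⟩
  rw [h1, Int.dvd_iff_emod_eq_zero]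

/-- A quotient passes the guard iff it is admissible with `Q > 0` (and `D` is not a square). [folklore] -/
theorem good_pr_iff (x : QuadIrr D) : Good D (pr x) ↔ ¬ IsSquare D ∧ x.IsAdmissible ∧ 0 < x.Q := by
  unfold Good IsAdmissible
  simp only [pr]
  constructor
  · rintro ⟨h1, h2, h3⟩; exact ⟨h1, ⟨h2.ne', h3⟩, h2⟩
  · rintro ⟨h1, ⟨_, h3⟩, h2⟩; exact ⟨h1, h2, h3⟩

/-- The guard is preserved by the Gauss step. [cite: Jozsa2003, §6.2 Prop. 21] -/
theorem good_gaussStepI {p : ℤ × ℤ} (h : Good D p) : Good D (gaussStepI D p) := by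
  obtain ⟨hD, hQ, hdvd⟩ := h
  let x : QuadIrr D := ⟨p.1, p.2⟩
  have hx : pr x = p := rfl
  rw [← hx, gaussStepI_pr, good_pr_iff]
  have := gaussStep_spec hD (x := x) ⟨hQ.ne', hdvd⟩ hQ
  exact ⟨hD, this.1, this.2⟩

/-- **The guarded Gauss step**: the Gauss step on good data, the identity otherwise. [folklore] -/
def gStepI (D : ℕ) (p : ℤ × ℤ) : ℤ × ℤ := if Good D p then gaussStepI D p else p

/-- Iterating the guarded step: the Gauss iteration on good data, frozen otherwise. [folklore] -/
theorem gStepI_iterate (D : ℕ) (n : ℕ) (p : ℤ × ℤ) :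
    (gStepI D)^[n] p = if Good D p then (gaussStepI D)^[n] p else p := by
  induction n generalizing p with
  | zero => simp
  | succ n ih =>
    rw [Function.iterate_succ_apply, Function.iterate_succ_apply]
    by_cases h : Good D p
    · rw [show gStepI D p = gaussStepI D p from if_pos h, ih, if_pos (good_gaussStepI h), if_pos h]
    · rw [show gStepI D p = p from if_neg h, ih, if_neg h, if_neg h]

/-- Good data stays good along the guarded iteration. [folklore] -/
theorem good_gStepI_iterate {p : ℤ × ℤ} (h : Good D p) (n : ℕ) : Good D ((gStepI D)^[n] p) := by
  rw [gStepI_iterate, if_pos h]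
  induction n with
  | zero => exact h
  | succ n ih => rw [Function.iterate_succ_apply']; exact good_gaussStepI ih

/-- The number of Gauss steps `log₄ Q + 3`. [cite: Jozsa2003, §6.2 Prop. 21 (⌈log₂(a/√D)⌉ + 1 steps)] -/
def stepsI (p : ℤ × ℤ) : ℕ := Nat.log 4 p.2.toNat + 3

/-- `stepsI = gaussSteps`. [folklore] -/
theorem stepsI_pr (x : QuadIrr D) : stepsI (pr x) = gaussSteps x := rfl

/-- **Reduction in integers**: `normalize ∘ gaussStep^{log₄ Q + 3}` on good data, the identity
otherwise. [cite: Jozsa2003, §6.2 Prop. 21] [cite: JacobsonWilliams2008, §5.4] -/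
def reduceI (D : ℕ) (p : ℤ × ℤ) : ℤ × ℤ :=
  if Good D p then normalizeI D ((gStepI D)^[stepsI p] p) else p

/-- `reduceI = reduce` on admissible quotients with `Q > 0`. [cite: Jozsa2003, §6.2 Prop. 21] -/
theorem reduceI_pr (hD : ¬ IsSquare D) {x : QuadIrr D} (h : x.IsAdmissible) (hQ : 0 < x.Q) :
    reduceI D (pr x) = pr (reduce x) := by
  have hg : Good D (pr x) := (good_pr_iff x).mpr ⟨hD, h, hQ⟩
  unfold reduceI reduce
  rw [if_pos hg, gStepI_iterate, if_pos hg, stepsI_pr, gaussStepI_iterate_pr,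
    normalizeI_pr (gaussIter_spec hD _ h hQ).2]

/-! ### `IsIdealShaped` is preserved -/

/-- The step with any quotient preserves ideal-shapedness (`Q' = −2c'` for the translated form).
[cite: Jozsa2003, §6.2 (reduction of ideals (a, b))] -/
theorem isIdealShaped_stepWith {x : QuadIrr D} (h : x.IsIdealShaped) (q : ℤ)
    (hQ' : 0 < (stepWith x q).Q) : (stepWith x q).IsIdealShaped := by
  obtain ⟨hQ, ⟨a, ha⟩, ⟨c, hc⟩⟩ := h
  -- `P'² − D = (P² − D) + Q·(q² Q − 2 q P)`, divisible by `2Q = 4a`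
  set P' := q * x.Q - x.P with hP'
  have hdiv : (P' ^ 2 - D) = 2 * x.Q * (c + (q ^ 2 * a - q * x.P)) := by
    rw [hP']
    have : x.P ^ 2 - (D : ℤ) = 2 * x.Q * c := hc
    linear_combination this + (q ^ 2 * x.Q) * ha
  have hQ'eq : (stepWith x q).Q = -(2 * (c + (q ^ 2 * a - q * x.P))) := by
    show ((D : ℤ) - P' ^ 2) / x.Q = _
    rw [show (D : ℤ) - P' ^ 2 = x.Q * (-(2 * (c + (q ^ 2 * a - q * x.P)))) by linarith [hdiv],
      Int.mul_ediv_cancel_left _ hQ.ne']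
  refine ⟨hQ', ⟨-(c + (q ^ 2 * a - q * x.P)), by rw [hQ'eq]; ring⟩, ⟨-a, ?_⟩⟩
  show P' ^ 2 - (D : ℤ) = 2 * (stepWith x q).Q * (-a)
  rw [hQ'eq, hdiv, ha]; ring

/-- `flipQ` preserves ideal-shapedness up to the sign condition. [folklore] -/
theorem isIdealShaped_flipQ {x : QuadIrr D} (h2 : 2 ∣ x.Q) (hd : 2 * x.Q ∣ x.P ^ 2 - D) (hQ : 0 < -x.Q) :
    (flipQ x).IsIdealShaped := by
  refine ⟨hQ, ?_, ?_⟩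
  · show 2 ∣ -x.Q; exact (dvd_neg).mpr h2
  · show 2 * -x.Q ∣ x.P ^ 2 - D
    rw [mul_neg]; exact (neg_dvd).mpr hd

/-- `shiftP` preserves ideal-shapedness. [folklore] -/
theorem isIdealShaped_shiftP {x : QuadIrr D} (h : x.IsIdealShaped) (k : ℤ) : (shiftP x k).IsIdealShaped := by
  obtain ⟨hQ, ⟨a, ha⟩, ⟨c, hc⟩⟩ := h
  refine ⟨hQ, ⟨a, ha⟩, ⟨c + k * x.P + k ^ 2 * a, ?_⟩⟩
  show (x.P + k * x.Q) ^ 2 - (D : ℤ) = 2 * x.Q * (c + k * x.P + k ^ 2 * a)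
  linear_combination hc + (k ^ 2 * x.Q) * ha

/-- **The baby step preserves ideal-shapedness** (on reduced data, where `Q' > 0`).
[cite: Jozsa2003, §6.2 Prop. 19 (ρ maps reduced ideals to reduced ideals)] -/
theorem isIdealShaped_step (hD : ¬ IsSquare D) {x : QuadIrr D} (h : x.IsIdealShaped) (hr : x.IsReduced) :
    (step x).IsIdealShaped := by
  rw [step_eq_stepWith]
  exact isIdealShaped_stepWith h _ (by rw [← step_eq_stepWith]; exact (isReduced_step hD hr).1)

/-- Divisibility data of a step with any quotient: `2 ∣ Q'` and `2Q' ∣ P'² − D` (no sign needed). [folklore] -/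
theorem two_dvd_stepWith {x : QuadIrr D} (h : x.IsIdealShaped) (q : ℤ) :
    2 ∣ (stepWith x q).Q ∧ 2 * (stepWith x q).Q ∣ (stepWith x q).P ^ 2 - D := by
  obtain ⟨hQ, ⟨a, ha⟩, ⟨c, hc⟩⟩ := h
  set P' := q * x.Q - x.P with hP'
  have hdiv : (P' ^ 2 - D) = 2 * x.Q * (c + (q ^ 2 * a - q * x.P)) := by
    rw [hP']
    have : x.P ^ 2 - (D : ℤ) = 2 * x.Q * c := hc
    linear_combination this + (q ^ 2 * x.Q) * ha
  have hQ'eq : (stepWith x q).Q = -(2 * (c + (q ^ 2 * a - q * x.P))) := by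
    show ((D : ℤ) - P' ^ 2) / x.Q = _
    rw [show (D : ℤ) - P' ^ 2 = x.Q * (-(2 * (c + (q ^ 2 * a - q * x.P)))) by linarith [hdiv],
      Int.mul_ediv_cancel_left _ hQ.ne']
  refine ⟨⟨-(c + (q ^ 2 * a - q * x.P)), by rw [hQ'eq]; ring⟩, ⟨-a, ?_⟩⟩
  show P' ^ 2 - (D : ℤ) = 2 * (stepWith x q).Q * (-a)
  rw [hQ'eq, hdiv, ha]; ring

/-- **The Gauss step preserves ideal-shapedness.** [cite: Jozsa2003, §6.2 Prop. 21] -/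
theorem isIdealShaped_gaussStep (hD : ¬ IsSquare D) {x : QuadIrr D} (h : x.IsIdealShaped) :
    (gaussStep x).IsIdealShaped := by
  have hadm := h.isAdmissible
  unfold gaussStep
  split_ifs with h1 h2
  · exact h
  · exact isIdealShaped_stepWith h _ h2
  · obtain ⟨h2', hd'⟩ := two_dvd_stepWith h (gaussQuot x)
    have hne : (gaussRaw x).Q ≠ 0 := (isAdmissible_stepWith hD hadm _).1
    refine isIdealShaped_flipQ h2' hd' ?_
    unfold gaussRaw at hne h2 ⊢
    omega

/-- Iterated Gauss steps preserve ideal-shapedness. [cite: Jozsa2003, §6.2 Prop. 21] -/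
theorem isIdealShaped_gaussIter (hD : ¬ IsSquare D) :
    ∀ (n : ℕ) {x : QuadIrr D}, x.IsIdealShaped → (gaussStep^[n] x).IsIdealShaped
  | 0, _, h => h
  | n + 1, _, h => by
    rw [Function.iterate_succ_apply]
    exact isIdealShaped_gaussIter hD n (isIdealShaped_gaussStep hD h)

/-- Normalisation preserves ideal-shapedness. [folklore] -/
theorem isIdealShaped_normalize {x : QuadIrr D} (h : x.IsIdealShaped) : (QuadIrr.normalize x).IsIdealShaped :=
  isIdealShaped_shiftP h _

/-- **Reduction preserves ideal-shapedness.** [cite: Jozsa2003, §6.2 Prop. 21] -/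
theorem isIdealShaped_reduce (hD : ¬ IsSquare D) {x : QuadIrr D} (h : x.IsIdealShaped) :
    (reduce x).IsIdealShaped :=
  isIdealShaped_normalize (isIdealShaped_gaussIter hD _ h)

/-! ### Size bounds -/

/-- Reduced data is small: `|P| ≤ D` and `0 < Q ≤ 2D + 1` (crudely, from `P ≤ ⌊√D⌋`, `Q ≤ 2⌊√D⌋ + 1`).
[cite: JacobsonWilliams2008, §3.3 (3.32)] -/
theorem IsReduced.size {x : QuadIrr D} (h : x.IsReduced) :
    x.P.natAbs ≤ D ∧ 0 < x.Q ∧ x.Q.natAbs ≤ 2 * D + 1 := by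
  obtain ⟨h1, h2, h3, h4⟩ := h.bounds
  have hs : Nat.sqrt D ≤ D := Nat.sqrt_le_self D
  refine ⟨?_, h.1, ?_⟩ <;> omega

/-- Along the Gauss iteration from good data, `Q` stays positive and below `max Q₀ D` (integer
form of `gaussIter_Q_le`, with `√D ≤ D`). [cite: Jozsa2003, §6.2 Prop. 21] -/
theorem Q_gaussIter_le (hD : ¬ IsSquare D) {x : QuadIrr D} (h : x.IsAdmissible) (hQ : 0 < x.Q) (n : ℕ) :
    0 < (gaussStep^[n] x).Q ∧ (gaussStep^[n] x).Q ≤ max x.Q D := by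
  refine ⟨(gaussIter_spec hD n h hQ).2, ?_⟩
  have h1 := gaussIter_Q_le hD n h hQ
  have hsq : Real.sqrt D ≤ (D : ℝ) := by
    rcases Nat.eq_zero_or_pos D with rfl | hD1
    · simp
    · have h1' : (1 : ℝ) ≤ D := by exact_mod_cast hD1
      calc Real.sqrt D ≤ Real.sqrt D * Real.sqrt D :=
            le_mul_of_one_le_right (Real.sqrt_nonneg _) (by rw [Real.one_le_sqrt]; exact h1')
        _ = D := Real.mul_self_sqrt (Nat.cast_nonneg _)
  have : ((gaussStep^[n] x).Q : ℝ) ≤ max (x.Q : ℝ) (D : ℝ) :=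
    h1.trans (max_le_max le_rfl hsq)
  have h2 : ((gaussStep^[n] x).Q : ℝ) ≤ ((max x.Q (D : ℤ) : ℤ) : ℝ) := by
    rw [Int.cast_max]; exact_mod_cast this
  exact_mod_cast h2

/-- One Gauss step keeps `|P|` below `max |P| Q/2`: either `P` is unchanged or `4P'² ≤ Q²`. [folklore] -/
theorem natAbs_P_gaussStep_le {x : QuadIrr D} (hQ : 0 < x.Q) :
    (gaussStep x).P.natAbs ≤ max x.P.natAbs x.Q.natAbs := by
  have hraw : (gaussRaw x).P.natAbs ≤ x.Q.natAbs := by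
    have h := sq_gaussRaw_P_le (x := x) hQ
    exact Int.natAbs_le_iff_sq_le.mpr (by nlinarith [sq_nonneg (gaussRaw x).P])
  unfold gaussStep
  split_ifs
  · exact le_max_left _ _
  · exact hraw.trans (le_max_right _ _)
  · show (gaussRaw x).P.natAbs ≤ _
    exact hraw.trans (le_max_right _ _)

/-- **Along the Gauss iteration `|P| ≤ max(|P₀|, Q₀, D)`.** [cite: Jozsa2003, §6.2 Prop. 21] -/
theorem natAbs_P_gaussIter_le (hD : ¬ IsSquare D) {x : QuadIrr D} (h : x.IsAdmissible) (hQ : 0 < x.Q) :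
    ∀ n : ℕ, (gaussStep^[n] x).P.natAbs ≤ max x.P.natAbs (max x.Q.natAbs D)
  | 0 => le_max_left _ _
  | n + 1 => by
    rw [Function.iterate_succ_apply']
    obtain ⟨hQn, hQle⟩ := Q_gaussIter_le hD h hQ n
    have ih := natAbs_P_gaussIter_le hD h hQ n
    refine (natAbs_P_gaussStep_le hQn).trans (max_le ih (le_trans ?_ (le_max_right _ _)))
    have : (gaussStep^[n] x).Q.natAbs ≤ max x.Q.natAbs D := by
      have h0 : 0 ≤ (gaussStep^[n] x).Q := hQn.le
      rcases le_max_iff.mp hQle with h1 | h1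
      · exact le_trans (by omega) (le_max_left _ _)
      · exact le_trans (by omega) (le_max_right _ _)
    exact this

/-- **Size of the guarded iteration on pairs**: from any good pair `(P, Q)`, every iterate `(Pₙ, Qₙ)`
has `|Pₙ|, |Qₙ| ≤ max(|P|, |Q|, D)`; from any other pair the iteration is frozen. [folklore] -/
theorem natAbs_gStepI_iterate_le (D : ℕ) (p : ℤ × ℤ) (n : ℕ) :
    ((gStepI D)^[n] p).1.natAbs ≤ max p.1.natAbs (max p.2.natAbs D) ∧
      ((gStepI D)^[n] p).2.natAbs ≤ max p.1.natAbs (max p.2.natAbs D) := by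
  rw [gStepI_iterate]
  by_cases hg : Good D p
  · rw [if_pos hg]
    obtain ⟨hD', hQ, hdvd⟩ := hg
    let x : QuadIrr D := ⟨p.1, p.2⟩
    have hx : pr x = p := rfl
    have hadm : x.IsAdmissible := ⟨hQ.ne', hdvd⟩
    rw [← hx, gaussStepI_iterate_pr]
    refine ⟨natAbs_P_gaussIter_le hD' hadm hQ n, ?_⟩
    obtain ⟨h0, h1⟩ := Q_gaussIter_le hD' hadm hQ n
    show (gaussStep^[n] x).Q.natAbs ≤ max x.P.natAbs (max x.Q.natAbs D)
    refine le_trans ?_ (le_max_right _ _)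
    rcases le_max_iff.mp h1 with h2 | h2
    · exact le_trans (by omega) (le_max_left _ _)
    · exact le_trans (by omega) (le_max_right _ _)
  · rw [if_neg hg]
    exact ⟨le_max_left _ _, le_trans (le_max_left _ _) (le_max_right _ _)⟩

/-- Size of a normalised good iterate: the result of `reduceI` on good data is reduced, hence small.
[cite: Jozsa2003, §6.2 Prop. 21] -/
theorem isReduced_reduceI {p : ℤ × ℤ} (hg : Good D p) :
    (⟨(reduceI D p).1, (reduceI D p).2⟩ : QuadIrr D).IsReduced := by
  obtain ⟨hD', hQ, hdvd⟩ := hg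
  let x : QuadIrr D := ⟨p.1, p.2⟩
  have hx : pr x = p := rfl
  have hadm : x.IsAdmissible := ⟨hQ.ne', hdvd⟩
  rw [← hx, reduceI_pr hD' hadm hQ]
  exact isReduced_reduce hD' hadm hQ

end InfraPrimitives

end Literature.Computability.Cryptography

end
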